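import Mathlib
import Summits.MatrixMultiplication.MatrixMultiplication.Theorems.SoloBlindFlatCheck

/-!
# The K♭ / E♭ checker: table bridges, truncation, `W⊥` and needs (combinatorial side)

Companion to `SoloBlindFlatCheck` (the executable checker).  Pure type-code combinatorics, no
configuration yet:

* table bridges: the memo tables `soloBlindMkFlatTabs m` agree with `soloBlindResid` / `soloBlindTSum`;
* truncation: the letter vector `t % 3^m` of a type code has the same letter digits, and it lies in
  the checker's `W⊥` whenever all residues of `t` over `F` vanish (`soloBlind_mem_wperp`);
* what each kind of need says about such a code (`soloBlind_needZ_perp`, `soloBlind_needX_perp`,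
  `soloBlind_needH_perp`), and a visibility criterion (`soloBlind_visible_of_resid_one`).

The configuration side (needs are met by visible block types; the core inside the block) is in
`SoloBlindFlatNeeds`.
-/

namespace Summit.MatrixMultiplication.MatrixMultiplication.Theorems

open Finset Module

/-! ## Table bridges -/

/-- Row-major index bound. -/
private theorem soloBlind_fidx_lt {a b k M : ℕ} (hk : k < a) (hM : M < b) : k * b + M < a * b := by
  calc k * b + M < k * b + b := by omega
    _ = (k + 1) * b := by ring
    _ ≤ a * b := Nat.mul_le_mul_right b hk

/-- Row-major index: quotient. -/
private theorem soloBlind_fidx_div {b k M : ℕ} (hM : M < b) : (k * b + M) / b = k := by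
  rw [Nat.mul_comm, Nat.mul_add_div (by omega), Nat.div_eq_of_lt hM, Nat.add_zero]

/-- Row-major index: remainder. -/
private theorem soloBlind_fidx_mod {b k M : ℕ} (hM : M < b) : (k * b + M) % b = M := by
  rw [Nat.add_mod, Nat.mul_mod_left, Nat.zero_add, Nat.mod_mod, Nat.mod_eq_of_lt hM]

/-- The `r1` table agrees with the spec. -/
theorem soloBlind_flatTabs_r1 {m t M : ℕ} (ht : t < 3 ^ (m + 1)) (hM : M < 2 ^ m) :
    soloBlindAGet (soloBlindMkFlatTabs m).r1 (t * 2 ^ m + M) = decide (soloBlindResid m t M = 1) := by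
  unfold soloBlindMkFlatTabs
  rw [soloBlindAGet_ofFn _ (soloBlind_fidx_lt ht hM)]
  simp only [soloBlind_fidx_div hM, soloBlind_fidx_mod hM]

/-- The `r2` table agrees with the spec. -/
theorem soloBlind_flatTabs_r2 {m t M : ℕ} (ht : t < 3 ^ (m + 1)) (hM : M < 2 ^ m) :
    soloBlindAGet (soloBlindMkFlatTabs m).r2 (t * 2 ^ m + M) = decide (soloBlindResid m t M = 2) := by
  unfold soloBlindMkFlatTabs
  rw [soloBlindAGet_ofFn _ (soloBlind_fidx_lt ht hM)]
  simp only [soloBlind_fidx_div hM, soloBlind_fidx_mod hM]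

/-- The `ts` table agrees with the spec. -/
theorem soloBlind_flatTabs_ts {m t M : ℕ} (ht : t < 3 ^ (m + 1)) (hM : M < 2 ^ m) :
    soloBlindNGet (soloBlindMkFlatTabs m).ts (t * 2 ^ m + M) = (soloBlindTSum m t M false).val := by
  unfold soloBlindNGet soloBlindMkFlatTabs
  rw [dif_pos (by rw [Array.size_ofFn]; exact soloBlind_fidx_lt ht hM), Array.getElem_ofFn]
  simp only [soloBlind_fidx_div hM, soloBlind_fidx_mod hM]

/-- The `tt` table agrees with the spec. -/
theorem soloBlind_flatTabs_tt {m t M : ℕ} (ht : t < 3 ^ (m + 1)) (hM : M < 2 ^ m) :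
    soloBlindNGet (soloBlindMkFlatTabs m).tt (t * 2 ^ m + M) = (soloBlindTSum m t M true).val := by
  unfold soloBlindNGet soloBlindMkFlatTabs
  rw [dif_pos (by rw [Array.size_ofFn]; exact soloBlind_fidx_lt ht hM), Array.getElem_ofFn]
  simp only [soloBlind_fidx_div hM, soloBlind_fidx_mod hM]

/-! ## Letter digits, truncation, and small `ZMod 3` facts -/

/-- Truncating a code to its `m` low digits keeps those digits. -/
theorem soloBlindDig_mod {m t a : ℕ} (ha : a < m) : soloBlindDig (t % 3 ^ m) a = soloBlindDig t a := by
  unfold soloBlindDig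
  congr 1
  obtain ⟨k, rfl⟩ := Nat.exists_eq_add_of_lt ha
  rw [show 3 ^ (a + k + 1) = 3 ^ a * 3 ^ (k + 1) from by rw [add_assoc, pow_add],
    Nat.mod_mul_right_div_self, Nat.mod_mod_of_dvd _ (dvd_pow_self 3 (Nat.succ_ne_zero k))]

/-- The letter sum of the truncated code is the letter sum of the code. -/
theorem soloBlindTSum_mod (m t M : ℕ) : soloBlindTSum m (t % 3 ^ m) M false = soloBlindTSum m t M false := by
  unfold soloBlindTSum
  simp only [Bool.false_eq_true, if_false, add_zero]
  exact Finset.sum_congr rfl fun a _ => soloBlindDig_mod a.2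

/-- The `τ`-augmented sum is the letter sum plus the `τ`-digit. -/
theorem soloBlindTSum_true (m t M : ℕ) :
    soloBlindTSum m t M true = soloBlindTSum m t M false + soloBlindDig t m := by
  unfold soloBlindTSum
  simp

/-- The letter sum is the `τ`-digit minus the residue. -/
theorem soloBlindTSum_false_eq (m t M : ℕ) :
    soloBlindTSum m t M false = soloBlindDig t m - soloBlindResid m t M := by
  unfold soloBlindTSum soloBlindResid
  simp

/-- In `ZMod 3`: an element different from `0` and `1` is `2`. -/
theorem soloBlind_zmod3_eq_two : ∀ a : ZMod 3, a ≠ 0 → a ≠ 1 → a = 2 := by decide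

/-! ## `W⊥` and what the needs say -/

/-- A code all of whose residues over `F` vanish has its letter vector in the checker's `W⊥`. -/
theorem soloBlind_mem_wperp {m : ℕ} {F : List ℕ} (hF : ∀ M ∈ F, M < 2 ^ m) {C₀ : ℕ} (hC₀ : C₀ ∈ F)
    {t : ℕ} (h0 : ∀ M ∈ F, soloBlindResid m t M = 0) :
    t % 3 ^ m ∈ soloBlindWPerp (soloBlindMkFlatTabs m) m F C₀ := by
  unfold soloBlindWPerp
  rw [List.mem_filter, List.mem_range, List.all_eq_true]
  have hw : t % 3 ^ m < 3 ^ (m + 1) :=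
    lt_of_lt_of_le (Nat.mod_lt _ (by positivity)) (Nat.pow_le_pow_right (by norm_num) (by omega))
  refine ⟨Nat.mod_lt _ (by positivity), fun M hM => ?_⟩
  unfold soloBlindWDiffZero
  rw [soloBlind_flatTabs_ts hw (hF M hM), soloBlind_flatTabs_ts hw (hF C₀ hC₀), soloBlindTSum_mod,
    soloBlindTSum_mod, soloBlindTSum_false_eq, soloBlindTSum_false_eq, h0 M hM, h0 C₀ hC₀]
  exact beq_self_eq_true _

/-- A zero-sum need is a nonzero mask below `2^m`. -/
theorem soloBlind_needZ_lt {T : SoloBlindFlatTabs} {m : ℕ} {Wp : List ℕ} {U : ℕ}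
    (hU : U ∈ soloBlindNeedZ T m Wp) : U < 2 ^ m ∧ U ≠ 0 := by
  unfold soloBlindNeedZ at hU
  rw [List.mem_filter, List.mem_range, Bool.and_eq_true] at hU
  exact ⟨hU.1, by simpa using hU.2.1⟩

/-- A zero-sum need `U` forces `∑_{a ∈ U} t_a = 0` for every code whose letter vector lies in `W⊥`. -/
theorem soloBlind_needZ_perp {m : ℕ} {Wp : List ℕ} {U : ℕ}
    (hU : U ∈ soloBlindNeedZ (soloBlindMkFlatTabs m) m Wp) {t : ℕ} (hw : t % 3 ^ m ∈ Wp) :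
    soloBlindTSum m t U false = 0 := by
  unfold soloBlindNeedZ at hU
  rw [List.mem_filter, List.mem_range, Bool.and_eq_true, List.all_eq_true] at hU
  obtain ⟨hU2, -, hall⟩ := hU
  have hw3 : t % 3 ^ m < 3 ^ (m + 1) :=
    lt_of_lt_of_le (Nat.mod_lt _ (by positivity)) (Nat.pow_le_pow_right (by norm_num) (by omega))
  have key := hall _ hw
  rw [beq_iff_eq, soloBlind_flatTabs_ts hw3 hU2, soloBlindTSum_mod] at key
  exact (ZMod.val_eq_zero _).mp key

/-- An exactness need is an absent mask below `2^m`. -/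
theorem soloBlind_needX_lt {T : SoloBlindFlatTabs} {m : ℕ} {F : List ℕ} {C₀ : ℕ} {Wp : List ℕ} {C : ℕ}
    (hC : C ∈ soloBlindNeedX T m F C₀ Wp) : C < 2 ^ m ∧ C ∉ F := by
  unfold soloBlindNeedX at hC
  rw [List.mem_filter, List.mem_range, Bool.and_eq_true] at hC
  refine ⟨hC.1, fun hmem => ?_⟩
  have h1 : F.elem C = true := List.elem_iff.mpr hmem
  have h2 := hC.2.1
  rw [h1] at h2
  exact Bool.false_ne_true h2

/-- An exactness need `C` has `resid(t, C) = resid(t, C₀)` for every code whose letter vector lies in `W⊥`. -/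
theorem soloBlind_needX_perp {m : ℕ} {F : List ℕ} {C₀ : ℕ} (hC₀ : C₀ < 2 ^ m) {Wp : List ℕ} {C : ℕ}
    (hC : C ∈ soloBlindNeedX (soloBlindMkFlatTabs m) m F C₀ Wp) {t : ℕ} (hw : t % 3 ^ m ∈ Wp) :
    soloBlindResid m t C = soloBlindResid m t C₀ := by
  unfold soloBlindNeedX at hC
  rw [List.mem_filter, List.mem_range, Bool.and_eq_true, List.all_eq_true] at hC
  obtain ⟨hC2, -, hall⟩ := hC
  have hw3 : t % 3 ^ m < 3 ^ (m + 1) :=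
    lt_of_lt_of_le (Nat.mod_lt _ (by positivity)) (Nat.pow_le_pow_right (by norm_num) (by omega))
  have key := hall _ hw
  unfold soloBlindWDiffZero at key
  rw [beq_iff_eq, soloBlind_flatTabs_ts hw3 hC2, soloBlind_flatTabs_ts hw3 hC₀, soloBlindTSum_mod,
    soloBlindTSum_mod, soloBlindTSum_false_eq, soloBlindTSum_false_eq] at key
  exact sub_right_injective (ZMod.val_injective _ key)

/-- An `H`-need is a mask below `2^m`. -/
theorem soloBlind_needH_lt {T : SoloBlindFlatTabs} {m : ℕ} {C₀ : ℕ} {Wp : List ℕ} {U : ℕ}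
    (hU : U ∈ soloBlindNeedH T m C₀ Wp) : U < 2 ^ m := by
  unfold soloBlindNeedH at hU
  rw [List.mem_filter, List.mem_range] at hU
  exact hU.1

/-- An `H`-need `U` forces `∑_{a ∈ U} t_a + ∑_{a ∈ C₀} t_a = 0` for every code whose letter vector
lies in `W⊥`. -/
theorem soloBlind_needH_perp {m : ℕ} {C₀ : ℕ} (hC₀ : C₀ < 2 ^ m) {Wp : List ℕ} {U : ℕ}
    (hU : U ∈ soloBlindNeedH (soloBlindMkFlatTabs m) m C₀ Wp) {t : ℕ} (hw : t % 3 ^ m ∈ Wp) :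
    soloBlindTSum m t U false + soloBlindTSum m t C₀ false = 0 := by
  unfold soloBlindNeedH at hU
  rw [List.mem_filter, List.mem_range, List.all_eq_true] at hU
  obtain ⟨hU2, hall⟩ := hU
  have hw3 : t % 3 ^ m < 3 ^ (m + 1) :=
    lt_of_lt_of_le (Nat.mod_lt _ (by positivity)) (Nat.pow_le_pow_right (by norm_num) (by omega))
  have key := hall _ hw
  rw [beq_iff_eq, soloBlind_flatTabs_ts hw3 hU2, soloBlind_flatTabs_ts hw3 hC₀, soloBlindTSum_mod,
    soloBlindTSum_mod, ← ZMod.val_add] at key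
  exact (ZMod.val_eq_zero _).mp key

/-- A code with no residue `2` over `F` and a residue `1` at some member is visible. -/
theorem soloBlind_visible_of_resid_one {m : ℕ} {F : List ℕ} (hF : ∀ M ∈ F, M < 2 ^ m) {t : ℕ}
    (ht : t < 3 ^ (m + 1)) (h2 : ∀ M ∈ F, soloBlindResid m t M ≠ 2) {M : ℕ} (hM : M ∈ F)
    (h1 : soloBlindResid m t M = 1) : soloBlindVisible (soloBlindMkFlatTabs m) m F t = true := by
  unfold soloBlindVisible
  rw [Bool.and_eq_true, List.all_eq_true, List.any_eq_true]
  refine ⟨fun M' hM' => ?_, ⟨M, hM, ?_⟩⟩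
  · rw [soloBlind_flatTabs_r2 ht (hF M' hM')]
    simpa using h2 M' hM'
  · rw [soloBlind_flatTabs_r1 ht (hF M hM)]
    simpa using h1

end Summit.MatrixMultiplication.MatrixMultiplication.Theorems
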